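import Summits.PneNP.PneNP.Theses.RamseyUncertifiable
import Literature.Combinatorics.SimpleGraph.FKPseudomoments
import Literature.Combinatorics.SimpleGraph.KYAssembly
import Literature.Combinatorics.SimpleGraph.FKVertexForm
import Literature.Combinatorics.SimpleGraph.PaleySelfComplementary
import Literature.Combinatorics.SimpleGraph.PaleyDegenerateModuli

/-!
# Skeleton line `two-pin-contraction-fkm-cores` for crux `PaleySosRung` (stmt-PneNP-9817)

Route `PneNP/RamseyUncertifiable`, crux decl
`Summit.PneNP.PneNP.Theses.RamseyUncertifiable.PaleySosRung`:
`∀ t ≥ 1, ∃ η > 0, ∃ p₀, ∀ primes p ≥ p₀ with p ≡ 1 (mod 4): p^η ≤ las⁽ᵗ⁾(P_p)`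
(`lasserreStableBound`, Laurent's program (22); `P_p = fromRel IsSquare (x − y) = paleyGraph p`,
`rfl`). Idea card `Cruxes/PaleySosRung/Ideas/two-pin-contraction-fkm-cores.md` (ideator 1; triage
r1: pass ×3 with the MANDATORY sharpen "state the core kernel bound on INJECTIVE supports only" —
honoured in `CoreKernelBounds` below). Line card: `Lines/two-pin-contraction-fkm-cores.md`.

## The line

Exhibit the FEIGE–KRAUTHGAMER PSEUDOMOMENTS `y_S = α_{|S|}·[S is a clique of P_p]` (tree
`fkMoments`, Kunisky–Yu Def. 2.7; the "simple"/MPW moments of Hopkins–Kothari–Potechin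
arXiv:1507.05230 §4 up to the clique-count correction) as a feasible point of Laurent's level-`t`
program for `P̄_p` (cliques of `P_p` = stable sets of `P̄_p`; `las⁽ᵗ⁾(P̄_p) = las⁽ᵗ⁾(P_p)` by
self-complementarity, tree `lasserreStableBound_compl_paleyGraph`) with value `p·α₁ ≥ p^η`. By the
Schur complement of the entry `y_∅ = 1`, `M_t(y) ⪰ 0` reduces to `H_t ⪰ 0` for the LEVEL-`t` FILLED
MATRIX `H_t[L,R] = α_{|L∪R|}·1_{L,R} − α_{|L|}α_{|R|}` on nonempty subsets of size `≤ t` (`filledMatrix`;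
at `t = 2` this is literally the tree's `kyFilledMatrix`, KY (35)–(37)) — STUB 1 (`FilledReduction`,
any graph, any level; the tree has `t = 2`: `posSemidef_momentMatrix_fkMoments`). The passage from
`M_t(y) ⪰ 0` to `p·α₁ ≤ las⁽ᵗ⁾(P̄_p) = las⁽ᵗ⁾(P_p)` is PROVED below (`rung_of_levelBudgetAt`).
`M_t(y) ⪰ 0` for `P_p` is the level-`t` version of Kunisky–Yu's Theorem 3.1 and the Paley version of
HKP's Theorem 1.2 (MPW/FK moments are PSD for `G(n,½)` up to `ω ≈ n^{1/(d+1)}` at degree `2d`, tight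
by Kelner's argument, ibid. §A): STUB 4 (`t = 2`: Kunisky–Yu's level, PROVABLE NOW from the tree's
FKM-free `LevelTwoQuarter` route), STUB 5 (`t = 3`, the next rung — Kunisky–Yu's open numerics
question lives here) and STUB 6 (`t ≥ 4`). The two Paley-specific inputs of that analysis are
isolated as STUB 2 and STUB 3:

* TWO-PIN CONTRACTION (`TwoPinLaw`, STUB 2): the affine maps `z ↦ x + (y − x)z` carry injective
  labellings with pins `(0,1)` to those with pins `(x,y)` and multiply a signed pattern with `e`
  edges by `χ(y − x)^e`; hence EVERY two-pin gadget sum is a scalar times a parity character,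
  `Σ_internal Π χ = c_B · χ(x − y)^{e(B)}`, EXACTLY. This is why `S² = pI − J`, why Kunisky–Yu's §7
  diamond is `(p−3)(I − J)`-shaped (`‖·‖ ≍ p²` against the random benchmark `p^{3/2}`), and why the
  tree's `KYShapeIdentities` could derive every norm bound of KY §4 but one from `S² = pI − J`: the
  COHERENT part of every graph matrix of `P_p` (everything behind a 2-separation, incl. all middle
  vertices of degree `≤ 2`) is an explicit scalar multiple of a lifted lower-level matrix and is
  moved into the Johnson-scheme ("expected") part of `H_t`, where HKP's eigenvalue bookkeeping
  absorbs it by re-balancing the levels `α_k` (as KY re-balanced `α₂, α₃, α₄`).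
* CORE KERNELS (`CoreKernelBounds`, STUB 3): what two-pin contraction cannot touch are the
  3-connected cores, at level `t` the complete bipartite JACOBI KERNELS
  `K_{i,j}[a,b] = Π_{k,l} χ(a_k − b_l) = (f_b / f_a)` (`f_a = Π(X − a_k)`; `i, j ≤ t`) on INJECTIVE
  tuples (triage r1-2/r1-3: on all tuples the `(3,3)` kernel has norm `≈ √3·p²` from the degenerate
  rows `a = (u,u,v)`; on injective tuples `≈ (1.2–1.9)·p^{7/4}`, kit j012337/j012561 and
  `K33KernelNumerics.md`, no `p²` law for `13 ≤ p ≤ 113`). STUB 3 registers the WEIL–SCHUR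
  exponent `ν(i,j) = max(max/2, min/2 + max/4)` (`(2,2) ↦ 3/2` = Kunisky–Yu's "naive `p^{3/2}`",
  Remark 4.21, = the tree's `abs_thetaForm_le_naive`; `(3,3) ↦ 9/4`; `(1,j) ↦ j/2` exact;
  `j ≥ 2i ↦ j/2` = benchmark), which is PROVABLE NOW from one-variable Weil (tree
  `norm_hybridSum_le`) + the Schur test + Newton/generating-function bookkeeping for injective
  column tuples. The planner's block-balance heuristic (line card §Budget; it reproduces exactly
  Kunisky–Yu's level-2 constraints `α√p ≪ 1`, `α^{3/2}p ≪ 1`, `α²‖T⁴⁴¹‖ ≪ 1` and HKP's threshold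
  `1/(d+1)` from the `(1,d)` star kernel) says this exponent SUFFICES for the full HKP exponent
  `1/(t+1) − ε` at every `t ≥ 3` (room `p^{3ε}` at the `(3,3)` core at `t = 3`, more above) and for
  `1/4 − ε` at `t = 2` (the tree's FKM-free `LevelTwoQuarter`); the Deligne-level bound
  `max/2 + 1/4` (KY Thm 3.35 = FKM15 Cor. 3.2 at `(2,2)`; numerically `7/4` at `(3,3)`) is needed
  ONLY for `η₂ > 1/4` (KY's `p^{1/3}`), which the crux does not ask for. If a budget proof at some
  block needs more than `ν`, the lead reshapes STUB 3 at that `(i,j)` (upgrade path in the card).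

`PaleySosRung_of` composes: `t = 1` from the tree (`las⁽¹⁾(P_p) = √p`,
`lasserreStableBound_paleyGraph_one`), `t = 2` from STUB 4, `t = 3` from STUB 5 and `t ≥ 4` from
STUB 6 (each fed STUBS 1–3), then feasibility of `fkMoments` (proved: `fkMoments_empty`,
`fkMoments_pair_of_not_adj`, `sum_fkMoments_singleton`) and the transport
`las⁽ᵗ⁾(P̄_p) = las⁽ᵗ⁾(P_p)`; no `sorry` outside the six `stub_*`. (The tree's `paleySosRung_level_two_quarter`, PaleySosLevelTwoNaive.lean,
is the `t = 2` rung outright; it is not imported here only because the farm had not built that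
module when this skeleton was checked — STUB 4 is its FK-PSD form and closes from the same file.)

## Registered obligations vs. targets (design note for the lead and for refuters)

STUBS 4–6 are registered in the ROBUST form `∃ η > 0` (FK moments feasible at SOME polynomial
scale), which is all the composition consumes and which dies only if the FK approach dies at that
level outright (the card's kill criterion: a coherently large 3-connected core breaking the budget
for EVERY choice of levels). The line's TARGET, recorded here and in the card, is every
`η < 1/(t+1)` (HKP Thm 1.2 for `P_p`; Kelner's argument caps FK/MPW-type moments there, and KY Thm 5.1
is the `t = 2` instance `FK₄ ≍ p^{1/3}`), and the predicted proof is ℓ-adic-free for `t ≥ 3`. They are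
NOT restatements of the crux: they assert feasibility of ONE explicit `(2t+1)`-parameter family of
pseudomoments (Kunisky–Yu's Theorem 3.1 + Prop. 3.3/3.5 is the `t = 2` case of exactly this
shape), stated on the MOMENT MATRIX itself (no filling artefact can make them false while the FK
approach lives), and the passage to `las⁽ᵗ⁾` is proved here.

## Disproof used (Cruxes/PaleySosRung/Disproof.lean v6, refuter-cdisprove-stmt-PneNP-9817-0, READ)

* `paleySosRung_false_without_levelPos` (`1 ≤ t`): honoured — `rung_of_levelBudgetAt` needs `1 ≤ t`
  (level `0` is junk, `lasserreStableBound_zero`), the composition splits `t = 1 / 2 / 3 / ≥ 4`.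
* `paleySosRung_false_without_modFour` (`p % 4 = 1`): used in STUBS 4–6 (for `p ≡ 3 (4)` the
  `fromRel` graph is `K_p` and `H_t` is not PSD at any polynomial scale) and in the composition
  (`lasserreStableBound_compl_paleyGraph`, `lasserreStableBound_paleyGraph_one` need it); STUBS 2–3
  hold for all primes (two-pin needs `χ(−1) = 1` only to identify `χ(x−y)` with `χ(y−x)`, which the
  scalar `c` absorbs).
* `paleySosRung_false_without_prime`: `ZMod p` is a field throughout (`Fact p.Prime`); the affine
  substitution of STUB 2 and Weil in STUB 3 use it.
* `exponent_le_half` / `lasserreStableBound_paleyGraph_le_sqrt`: respected — targets `1/(t+1) ≤ 1/2`,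
  equality only at `t = 1` where the composition uses `las⁽¹⁾ = √p` exactly.
* refuted strengthenings `not_paleySosRungSqrtAllLevels`, `not_paleySosRungSqrtEventually`: not
  approached (`η_t → 0`; `p₀` depends on `t` and `η`).
* `paleySosRung_iff_forall_prime` (`p₀` cosmetic): not used; stubs keep `p₀` for convenience.
* Targets / near-misses: none in v6. No `Theorems/PaleySosRung/Negative/*` has landed (nothing to
  import); `ledger negatives --problem PneNP` (5 items) has no statement about Lasserre values,
  Paley graphs or character sums — no stub is an instance of a refuted statement.

Conventions: `sorry` appears ONLY in the six `stub_*` theorems; `PaleySosRung_of` is a real proof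
whose conclusion is literally the route decl (hypotheses = the name-keyed aliases
`Registered.stub_*`); `PaleySosRung_closed` is the same composition fed with the stubs.
-/

set_option linter.unusedVariables false
set_option linter.unusedSectionVars false
set_option linter.dupNamespace false

namespace Summit.PneNP.PneNP.Cruxes.PaleySosRung.TwoPinContractionFkmCores

open scoped BigOperators Matrix
open Finset Matrix Literature.Combinatorics.SimpleGraph

noncomputable section

/-! ### Objects -/

/-- Index type of the level-`t` filled matrix: NONEMPTY subsets of size `≤ t` (at `t = 2` this is
the tree's `PairIdx`, Kunisky–Yu (29)). -/
abbrev LevelIdx (W : Type*) (t : ℕ) : Type _ := {S : Finset W // 1 ≤ S.card ∧ S.card ≤ t}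

variable {V : Type*} [Fintype V] [DecidableEq V]

open Classical in
/-- **The level-`t` filled matrix** `H_t[L,R] = α_{|L ∪ R|}·1_{L,R} − α_{|L|}·α_{|R|}` on nonempty
`L, R` with `|L|, |R| ≤ t`, where `1_{L,R}` (tree `bipInd`) says that every vertex of `L ∖ R` is
adjacent to every vertex of `R ∖ L` (Kunisky–Yu Def. 3.4, Prop. 3.5). For `t = 2` these are KY's
(35)–(37) (`kyFilledMatrix`). The Schur complement of `y_∅ = 1` in `M_t(fkMoments G α)` is `D H_t D`
with `D` the diagonal clique indicator (tree `fkMoments_union_sub_mul`). Adjacency is decided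
classically so that the matrix carries no instance argument. [cite: KuniskyYu2022, (35)–(37)] -/
def filledMatrix (G : SimpleGraph V) (t : ℕ) (α : ℕ → ℝ) :
    Matrix (LevelIdx V t) (LevelIdx V t) ℝ :=
  Matrix.of fun L R => α (L.1 ∪ R.1).card * bipInd G L.1 R.1 - α L.1.card * α R.1.card

/-- The quadratic character of `𝔽_p` as a real number (`0` at `0`): the Seidel entry `S_{xy} = χ(x−y)`
of the Paley graph for `p ≡ 1 (mod 4)` (tree `paley_seidel_apply`). -/
def chi (p : ℕ) [Fact p.Prime] (x : ZMod p) : ℝ := ((quadraticChar (ZMod p) x : ℤ) : ℝ)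

open Classical in
/-- **Two-pin gadget sum.** A gadget is a signed multigraph pattern on `b + 2` vertices given as a
finite set `E` of ORDERED pairs (direction is immaterial up to `χ(−1)`; a loop contributes `χ(0) = 0`),
whose vertices `0` and `1` are the PINS. `gadgetSum p b E x y` sums `Π_{(u,v) ∈ E} χ(ℓ u − ℓ v)` over
all INJECTIVE labellings `ℓ : Fin (b+2) → 𝔽_p` with `ℓ 0 = x`, `ℓ 1 = y` (graph-matrix convention:
distinct vertices get distinct labels). Examples: one internal vertex joined to both pins =
Jacobsthal, `−1` for `x ≠ y` (tree `sum_quadraticChar_mul_add_eq_neg_one` up to the two excluded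
labels); Kunisky–Yu's §7 diamond (two internal vertices, each joined to both pins) = `(p−3) + O(1)`. -/
def gadgetSum (p : ℕ) [Fact p.Prime] (b : ℕ) (E : Finset (Fin (b + 2) × Fin (b + 2)))
    (x y : ZMod p) : ℝ :=
  ∑ ℓ : Fin (b + 2) → ZMod p,
    if Function.Injective ℓ ∧ ℓ 0 = x ∧ ℓ 1 = y then ∏ e ∈ E, chi p (ℓ e.1 - ℓ e.2) else 0

/-- **The Jacobi kernel** `K_{i,j}[a,b] = Π_{k<i, l<j} χ(a_k − b_l)` on `i`-tuples × `j`-tuples of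
`𝔽_p` — the graph matrix of the complete bipartite cross pattern `K_{i,j}` of the Paley graph
(`(2,2)` is Kunisky–Yu's `T^{4,4,1}` kernel `χ(a−c)χ(a−d)χ(b−c)χ(b−d)`, tree `PaleyT441*`). For split
`f_a = Π(X − a_k)`, `f_b`, it is the polynomial Jacobi symbol `χ(Res(f_a, f_b))`. It vanishes as
soon as some `a_k = b_l`. -/
def jacobiKernel (p : ℕ) [Fact p.Prime] (i j : ℕ) (a : Fin i → ZMod p) (b : Fin j → ZMod p) : ℝ :=
  ∏ k : Fin i, ∏ l : Fin j, chi p (a k - b l)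

/-- **The Weil–Schur exponent** `ν(i,j) = max(max(i,j)/2, min(i,j)/2 + max(i,j)/4)` of STUB 3:
`(1,j) ↦ j/2` (exact), `(2,2) ↦ 3/2` (KY's naive bound), `(2,3) ↦ 7/4`, `(3,3) ↦ 9/4`, `(i,j) ↦ j/2`
= the random benchmark whenever `j ≥ 2i`. The conjectured truth on injective supports is
`max/2 + o(1)` up to at most `+1/4` (`(2,2)`: `‖T⁴⁴¹‖ ≈ 2p`, KY Thm 3.35 gives `5/4` from FKM;
`(3,3)`: `p^{1.5}–p^{1.75}` numerically). -/
def coreExponent (i j : ℕ) : ℝ :=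
  max (((max i j : ℕ) : ℝ) / 2) (((min i j : ℕ) : ℝ) / 2 + ((max i j : ℕ) : ℝ) / 4)

open Classical in
/-- **Level-`t` budget for the Paley family** (the shape of STUBS 4–6): for some exponent `η > 0`
and all large primes `p ≡ 1 (mod 4)` there are FK levels `α` (`α₀ = 1`) with `p·α₁ ≥ p^η` whose
FK pseudomoments `y_S = α_{|S|}[S clique of P_p]` (tree `fkMoments`) have a positive semidefinite
level-`t` MOMENT MATRIX `M_t(y)` (tree `momentMatrix`) — Kunisky–Yu's Theorem 3.1 (+ Prop. 3.3/3.5)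
is the case `t = 2`, `p·α₁ = c·p^{1/3}`. TARGET of the line: every `η < 1/(t+1)` (HKP Thm 1.2 for
`P_p`). The intended route to `M_t(y) ⪰ 0` is STUB 1 (`H_t ⪰ 0` suffices). -/
def LevelBudgetAt (t : ℕ) : Prop :=
  ∃ η : ℝ, 0 < η ∧ ∃ p₀ : ℕ, ∀ p ≥ p₀, p.Prime → p % 4 = 1 →
    ∃ α : ℕ → ℝ, α 0 = 1 ∧ (p : ℝ) ^ η ≤ (p : ℝ) * α 1 ∧
      (momentMatrix t (fkMoments (paleyGraph p) α)).PosSemidef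

/-! ### The six stub STATEMENTS (named `Prop`s; the registered `stub_*` theorems below restate them
verbatim, and `Registered.stub_*` are the name-keyed aliases used as hypotheses of `PaleySosRung_of`) -/

open Classical in
/-- Statement of STUB 1 — **the filled-matrix reduction at every level, for every finite graph**:
if `α₀ = 1` and the level-`t` filled matrix of `G` is PSD, then so is the level-`t` moment matrix of
the FK pseudomoments `fkMoments G α` (Kunisky–Yu Prop. 3.3 + 3.5 / §2.3 steps 1–2, one level up;
HKP's "fill in the zero rows" device). [cite: KuniskyYu2022, §2.3, Prop. 3.3, Prop. 3.5] -/
def FilledReduction : Prop :=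
  ∀ (n t : ℕ) (G : SimpleGraph (Fin n)) (α : ℕ → ℝ), α 0 = 1 →
    (filledMatrix G t α).PosSemidef → (momentMatrix t (fkMoments G α)).PosSemidef

/-- Statement of STUB 2 — **two-pin contraction law**: for every prime `p`, every gadget `(b, E)`
there is a scalar `c = c_{b,E}(p)` with `gadgetSum p b E x y = c · χ(x − y)^{|E|}` for all `x ≠ y`.
[folklore; the card's `TwoPinContraction`] -/
def TwoPinLaw : Prop :=
  ∀ (p : ℕ) [Fact p.Prime] (b : ℕ) (E : Finset (Fin (b + 2) × Fin (b + 2))),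
    ∃ c : ℝ, ∀ x y : ZMod p, x ≠ y → gadgetSum p b E x y = c * chi p (x - y) ^ E.card

/-- Statement of STUB 3 — **core kernel bounds on injective supports** (bilinear-form = operator-norm
language): for all `i, j ≥ 1` there is `C = C(i,j)` such that for every prime `p` and all `x`, `y`
supported on INJECTIVE tuples, `|Σ_{a,b} x_a y_b K_{i,j}[a,b]| ≤ C·p^{ν(i,j)}·‖x‖₂‖y‖₂`.
[cite: KuniskyYu2022, Remark 4.21 (the `(2,2)` case)] -/
def CoreKernelBounds : Prop :=
  ∀ i j : ℕ, 1 ≤ i → 1 ≤ j → ∃ C : ℝ, ∀ (p : ℕ) [Fact p.Prime],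
    ∀ (x : (Fin i → ZMod p) → ℝ) (y : (Fin j → ZMod p) → ℝ),
      (∀ a, ¬ Function.Injective a → x a = 0) → (∀ b, ¬ Function.Injective b → y b = 0) →
      |∑ a, ∑ b, x a * y b * jacobiKernel p i j a b| ≤
        C * (p : ℝ) ^ coreExponent i j * Real.sqrt (∑ a, x a ^ 2) * Real.sqrt (∑ b, y b ^ 2)

/-- Statement of STUB 4 — **Kunisky–Yu's level in FK-PSD form**: the three tools give the level-`2`
budget for the Paley family (a theorem of the tree up to packaging: FKM-free with every `η < 1/4`;
`η < 1/3` with FKM). [cite: KuniskyYu2022, Theorem 3.1] -/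
def LevelTwoBudget : Prop := FilledReduction → TwoPinLaw → CoreKernelBounds → LevelBudgetAt 2

/-- Statement of STUB 5 — **the next rung**: the filled reduction, the two-pin law and the core kernel
bounds give the level-`3` budget for the Paley family. [conjecture of this line; target every
`η < 1/4`] -/
def LevelThreeBudget : Prop := FilledReduction → TwoPinLaw → CoreKernelBounds → LevelBudgetAt 3

/-- Statement of STUB 6 — **all higher rungs**: the same at every level `t ≥ 4` (with `η_t`, `p₀`
depending on `t`). [conjecture of this line; target every `η < 1/(t+1)`] -/
def HigherLevelBudget : Prop :=
  FilledReduction → TwoPinLaw → CoreKernelBounds → ∀ t : ℕ, 4 ≤ t → LevelBudgetAt t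

/-! ### The six registered stubs (`sorry` lives ONLY in these six theorems) -/

open Classical in
/-- **STUB 1 — the filled-matrix reduction at level `t` (provable now; M).** For `α₀ = 1`,
`H_t(G, α) ⪰ 0 ⟹ M_t(fkMoments G α) ⪰ 0`. Proof plan (the tree's `posSemidef_momentMatrix_fkMoments`
one level up, same argument): with `y = fkMoments G α`, `y_∅ = α₀ = 1` (`fkMoments_empty`); split
`P_t(V)` into `∅` and `LevelIdx V t` (`sum_levelTwo_eq_add_sum_pairIdx` generalised), write
`xᵀ M_t(y) x = (x_∅ + Σ_L y_L x_L)² + Σ_{L,R ≠ ∅} x_L x_R (y_{L∪R} − y_L y_R)` and use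
`fkMoments_union_sub_mul`: `y_{L∪R} − y_L y_R = d_L d_R H_t[L,R]` with `d` the clique indicator, so
the second sum is `(d∘x)ᵀ H_t (d∘x) ≥ 0` (the tree's `bipInd` at `[DecidableRel G.Adj]` and the
classical instances inside `filledMatrix` / this statement agree by `Subsingleton (Decidable _)`).
No hypothesis `1 ≤ t` is needed here (at `t = 0` both sides are trivially PSD); the level enters only
in `rung_of_levelBudgetAt` (Disproof `paleySosRung_false_without_levelPos`). Used by STUBS 4–6 as the
route to `M_t ⪰ 0`. -/
theorem stub_filledReduction :
    ∀ (n t : ℕ) (G : SimpleGraph (Fin n)) (α : ℕ → ℝ), α 0 = 1 →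
      (filledMatrix G t α).PosSemidef → (momentMatrix t (fkMoments G α)).PosSemidef := by
  sorry

/-- **STUB 2 — two-pin contraction law (provable now; M⁻).** Proof plan: for `x ≠ y` the map
`ℓ' ↦ (k ↦ x + (y − x)·ℓ' k)` is a bijection of `Fin (b+2) → ZMod p` (`y − x` is a unit of the
field `ZMod p`) preserving injectivity and carrying the pin conditions `ℓ' 0 = 0, ℓ' 1 = 1` to
`ℓ 0 = x, ℓ 1 = y`; each factor transforms as `χ(ℓ u − ℓ v) = χ(y − x)·χ(ℓ' u − ℓ' v)`
(`map_mul`), so `gadgetSum p b E x y = χ(y−x)^{|E|} · gadgetSum p b E 0 1`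
(`Fintype.sum_equiv`, `Finset.prod_mul_distrib`, `Finset.prod_const`), and
`χ(y − x) = χ(−1)χ(x − y)`; take `c := χ(−1)^{|E|} · gadgetSum p b E 0 1`. Holds for every prime;
`p ≡ 1 (mod 4)` (`χ(−1) = 1`, tree `quadraticChar_neg_eq`) only makes `c = gadgetSum p b E 0 1`.
Used by STUBS 4–5 to evaluate every 2-separated piece of the Schur-complement expansion of `H_t`
EXACTLY (the coherent part), cf. Kunisky–Yu §7 and the tree's `KYShapeIdentities`. -/
theorem stub_twoPinLaw :
    ∀ (p : ℕ) [Fact p.Prime] (b : ℕ) (E : Finset (Fin (b + 2) × Fin (b + 2))),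
      ∃ c : ℝ, ∀ x y : ZMod p, x ≠ y → gadgetSum p b E x y = c * chi p (x - y) ^ E.card := by
  sorry

/-- **STUB 3 — core kernel bounds at the Weil–Schur exponent (provable now; L).** Proof plan, for
`i ≤ j` (else transpose): restrict `K = K_{i,j}` to injective rows/columns (the hypotheses on `x`,
`y`); `|xᵀ K y| ≤ ‖K‖·‖x‖‖y‖` and `‖K‖² ≤ max_a Σ_{a'} |(K Kᵀ)[a,a']|` (Schur test; in form language:
Cauchy–Schwarz + AM–GM as in the tree's `abs_thetaForm_le_naive`). Here
`(K Kᵀ)[a,a'] = Σ_{b injective} Π_l g(b_l)` with `g(z) = χ(f_a(z) f_{a'}(z))`, i.e. `j!·e_j(g)`, a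
polynomial in the power sums `Σ_z g(z)^k` = `#{g ≠ 0}` (`k` even) or `U := Σ_z g(z)` (`k` odd)
(equivalently the `x^j`-coefficient of `(1+x)^P (1−x)^M`, `P − M = U`, `P + M ≤ p`), whence
`|(K Kᵀ)[a,a']| ≤ C_j (p^{j/2} + |U|^j)`. If `set a' = set a` (`i!` rows) the entry is
`#{b} ≤ p^j`; otherwise `f_a f_{a'} = (square)·h` with `h` split squarefree of degree
`|set a Δ set a'| ≥ 2`, so `|U| ≤ (2i−1)√p + 2i` by Weil (tree `HybridLFunction.norm_hybridSum_le`,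
additive twist `0`). Row sums `≤ i!·p^j + C·p^{i + j/2}`, so `‖K‖ ≤ C'·(p^{j/2} + p^{i/2 + j/4})
≤ 2C'·p^{ν(i,j)}`; small primes are absorbed in `C`. Sanity: `(1,j)`: `p^{j/2}` is exact
(`K Kᵀ = ((p−1)^j + …)I − …`); `(2,2)`: `3/2` = KY Remark 4.21; refuted variant avoided: WITHOUT the
injective-support hypotheses the `(3,3)` form is `≥ (1−o(1))p²‖x‖‖y‖` (triage r1-2 §2, r1-3; kit
j012337: `‖K‖_all/p² → √3`), which is why they are there. Conjectured truth `max/2 + 1/4` or better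
(FKM15 "sums of products" / a function-field quadratic large sieve, triage r1-1 sharpen) is the
upgrade path if a budget block needs it; see the card. -/
theorem stub_coreKernels :
    ∀ i j : ℕ, 1 ≤ i → 1 ≤ j → ∃ C : ℝ, ∀ (p : ℕ) [Fact p.Prime],
      ∀ (x : (Fin i → ZMod p) → ℝ) (y : (Fin j → ZMod p) → ℝ),
        (∀ a, ¬ Function.Injective a → x a = 0) → (∀ b, ¬ Function.Injective b → y b = 0) →
        |∑ a, ∑ b, x a * y b * jacobiKernel p i j a b| ≤
          C * (p : ℝ) ^ coreExponent i j * Real.sqrt (∑ a, x a ^ 2) * Real.sqrt (∑ b, y b ^ 2) := by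
  sorry

/-- **STUB 4 — the level-2 budget in FK-PSD form (provable now; M).** For some `η > 0` (in fact
every `η < 1/4`) and all large primes `p ≡ 1 (mod 4)`: levels `α = (1, a, 4a², 256a³, 2¹⁸a⁴, 0, …)`
with `a = 2⁻⁸p^{−3/4}` make `H₂(P_p, α) ⪰ 0` and `p·α₁ = 2⁻⁸p^{1/4} ≥ p^η`. Proof plan (all in the
tree): `S := Seidel matrix of P_p` satisfies `hS`, `hrow` (`sum_paley_seidel`), `hsq`
(`paley_seidel_mul_self`: `S² = pI − J`, the two-pin law for the one-middle-vertex gadget) and the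
`T⁴⁴¹` bound `hΘ` with `K = p√p` (`abs_thetaForm_le_naive`, PaleySosLevelTwoNaive.lean = STUB 3 at
`(2,2)`, `ν = 3/2`); the numeric side conditions `h1–h5`, `hK` hold for `p ≥ 2³²` exactly as in
`conference_lasserre_two_ge_quarter`; then `KYAssembly.conference_vertexForm_nonneg`,
`FKVertexForm.posSemidef_kyFilledMatrix_of_vertexForm` and `posSemidef_momentMatrix_fkMoments` give
`M₂(fkMoments (paleyGraph p) α) ⪰ 0` (equivalently: `kyFilledMatrix G α = filledMatrix G 2 α`
entrywise — same index type `PairIdx`, `bipInd` instances agree by `Subsingleton (Decidable _)` — and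
STUB 1). With FKM (`kuniskyYu2022_theorem_1_2_of_kloosterman4`'s hypothesis) the same route gives
every `η < 1/3` (KY Thm 3.1). This stub validates the level-`t` plumbing against Kunisky–Yu's level;
it is the FK-PSD form of the tree's `paleySosRung_level_two_quarter`. -/
theorem stub_levelTwo : FilledReduction → TwoPinLaw → CoreKernelBounds → LevelBudgetAt 2 := by
  sorry

/-- **STUB 5 — the level-3 budget for the Paley family (the next rung; L–XL, open).** Given the
two-pin law and the core kernel bounds: for some `η > 0` and all large primes `p ≡ 1 (mod 4)` there
are levels `α₀ = 1, α₁, …, α₆` with `p·α₁ ≥ p^η` and `M₃(y) ⪰ 0`, via `H₃(P_p, α) ⪰ 0` and STUB 1.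
TARGET every `η < 1/4`
(HKP Thm 1.2 at `d = 3` for `P_p`; Kelner caps FK-type moments at `p^{1/4}`), predicted ℓ-adic-free.
Proof plan = Kunisky–Yu §3–4 one level up inside HKP's `E + D` architecture (arXiv:1507.05230 §5–7):
(i) choose `α_k = κ_k α^k`, `α = p^{−3/4−ε}`; (ii) `E`-part: the Johnson-scheme matrix of `H₃` with
the EXACT two-pin scalars of all 2-separated pieces of the Schur-complement expansion folded in
(STUB 2; at level 2 these are `S² = pI − J`, `S𝟙 = 0`, Jacobsthal `−1`, the diamond `p − 3`) has
eigenvalues `≳ α^i` on block `i` after re-balancing the `κ_k`; (iii) `D`-part: lifted patterns by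
HKP's lifting lemmas, spanning cross patterns on block `(i,j)` by `α^{(i+j)/2}·‖pattern‖ ≪ 1`:
`(1,1)`: `α√p`, `(1,2)`: `α^{3/2}p`, `(1,3)`: `α²p^{3/2}` (binding, gives `1/4`), `(2,2)`:
`α²·p^{3/2}` (STUB 3, `ν = 3/2`; room `p^{2ε}`), `(2,3)`: `α^{5/2}p^{7/4}` (room `p^{1/8}`), `(3,3)`:
`α³p^{9/4}` (STUB 3, `ν = 9/4`; room `p^{3ε}`); ≥3-pin gadgets (functions of cross-ratios, e.g.
`λ(a,b,c) = −χ(b−a)·a_p(E_r)`) by Weil. Registered in the robust form `∃ η > 0`: it fails only if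
FK moments fail on `P_p` at level 3 at every polynomial scale (a coherently large core; none seen:
`‖K_{3,3}‖_inj ≲ 1.9 p^{7/4}`, `13 ≤ p ≤ 113`). `p ≡ 1 (mod 4)` is load-bearing (Disproof
`paleySosRung_false_without_modFour`: for `p ≡ 3 (4)` the graph is `K_p`). -/
theorem stub_levelThree : FilledReduction → TwoPinLaw → CoreKernelBounds → LevelBudgetAt 3 := by
  sorry

/-- **STUB 6 — the budget at every level `t ≥ 4` (XL, open).** Same statement and plan at level
`t`, uniformly: HKP's degree-`2d` analysis (arXiv:1507.05230 Thm 1.2, §5–7: Johnson-scheme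
eigenvalues of `E`, lifting, norm bounds for the finitely many pattern classes per level) with (a)
every `G(n,½)` trace-method norm bound replaced by the two-pin scalar (2-separated pieces, exact,
moved into `E`) or by STUB 3 / Weil (3-connected pieces), and (b) the levels `κ_k` re-balanced
against the explicit scalars. TARGET every `η < 1/(t+1)` with `α = p^{−t/(t+1)−ε}`; the block
heuristic gives room `p^{tε}` at `(t,t)` with `ν(t,t) = 3t/4` and the binding constraint at the star
kernel `(1,t)` (exact norm `p^{t/2}`). Registered as `∃ η_t > 0` per level. The honest risk (the
card's kill): a coherent scalar of the wrong sign/size in (b) destroying `E ≻ 0` on some block for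
every choice of `κ`, or a 3-connected core coherently above `p^{ν}` — impossible for `ν` as
registered (STUB 3 is a theorem-to-be), so the risk sits entirely in (b). -/
theorem stub_higherLevels :
    FilledReduction → TwoPinLaw → CoreKernelBounds → ∀ t : ℕ, 4 ≤ t → LevelBudgetAt t := by
  sorry

/-! ### Name-keyed aliases of the six statements (the hypotheses of the composition) -/
namespace Registered

/-- Alias of `FilledReduction` keyed by the registered stub name. -/
abbrev stub_filledReduction : Prop := FilledReduction
/-- Alias of `TwoPinLaw` keyed by the registered stub name. -/
abbrev stub_twoPinLaw : Prop := TwoPinLaw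
/-- Alias of `CoreKernelBounds` keyed by the registered stub name. -/
abbrev stub_coreKernels : Prop := CoreKernelBounds
/-- Alias of `LevelTwoBudget` keyed by the registered stub name. -/
abbrev stub_levelTwo : Prop := LevelTwoBudget
/-- Alias of `LevelThreeBudget` keyed by the registered stub name. -/
abbrev stub_levelThree : Prop := LevelThreeBudget
/-- Alias of `HigherLevelBudget` keyed by the registered stub name. -/
abbrev stub_higherLevels : Prop := HigherLevelBudget

end Registered

/-! ### Composition (proved) -/

open Classical in
/-- **From a level budget to the rung at that level** (proved, no stub): the FK pseudomoments with
`α₀ = 1` and `M_t(y) ⪰ 0` are feasible for Laurent's program (22) of `P̄_p` (`fkMoments_empty`,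
`fkMoments_pair_of_not_adj`) with value `p·α₁` (`sum_fkMoments_singleton`), so
`p^η ≤ p·α₁ ≤ las⁽ᵗ⁾(P̄_p) = las⁽ᵗ⁾(P_p)` (`lasserreStableBound_compl_paleyGraph`, `1 ≤ t`) and
`paleyGraph p = fromRel …` (`rfl`). [cite: KuniskyYu2022, §2.3 and (26)] -/
theorem rung_of_levelBudgetAt {t : ℕ} (ht : 1 ≤ t) (hB : LevelBudgetAt t) :
    ∃ η : ℝ, 0 < η ∧ ∃ p₀ : ℕ, ∀ p ≥ p₀, p.Prime → p % 4 = 1 →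
      (p : ℝ) ^ η ≤ lasserreStableBound
        (_root_.SimpleGraph.fromRel fun x y : Fin p => IsSquare (x - y)) t := by
  obtain ⟨η, hη, p₀, H⟩ := hB
  refine ⟨η, hη, p₀, fun p hp hprime h4 => ?_⟩
  obtain ⟨α, hα0, hval, hpsd⟩ := H p hp hprime h4
  have hfeas : IsLasserreFeasible (paleyGraph p)ᶜ t (fkMoments (paleyGraph p) α) := by
    refine ⟨?_, ?_, hpsd⟩
    · rw [fkMoments_empty, hα0]
    · intro u v huv
      rw [SimpleGraph.compl_adj] at huv
      exact fkMoments_pair_of_not_adj _ α huv.1 huv.2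
  have hle := hfeas.sum_singleton_le_lasserreStableBound ht
  rw [sum_fkMoments_singleton, Fintype.card_fin,
    lasserreStableBound_compl_paleyGraph hprime h4 ht] at hle
  rw [← paleyGraph_eq_fromRel]
  exact hval.trans hle

/-- **Composition.** The six stubs imply the crux BY NAME: `t = 1` is `las⁽¹⁾(P_p) = √p` (tree),
`t = 2` is STUB 4, `t = 3` is STUB 5 and `t ≥ 4` is STUB 6 (each fed STUBS 1–3), pushed to the rung
by `rung_of_levelBudgetAt`. Nothing is admitted in this proof. -/
theorem PaleySosRung_of (hR : Registered.stub_filledReduction) (hP : Registered.stub_twoPinLaw)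
    (hC : Registered.stub_coreKernels) (h2 : Registered.stub_levelTwo)
    (h3 : Registered.stub_levelThree) (hH : Registered.stub_higherLevels) :
    Summit.PneNP.PneNP.Theses.RamseyUncertifiable.PaleySosRung := by
  intro t ht
  rcases (show t = 1 ∨ t = 2 ∨ t = 3 ∨ 4 ≤ t by omega) with rfl | rfl | rfl | h4
  · -- level 1: `las⁽¹⁾(P_p) = √p`
    refine ⟨1 / 2, by norm_num, 0, fun p _ hp hp4 => ?_⟩
    rw [← paleyGraph_eq_fromRel, lasserreStableBound_paleyGraph_one hp hp4, Real.sqrt_eq_rpow]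
  · -- level 2: Kunisky–Yu's level (FKM-free form)
    exact rung_of_levelBudgetAt (by norm_num) (h2 hR hP hC)
  · -- level 3: the next rung
    exact rung_of_levelBudgetAt (by norm_num) (h3 hR hP hC)
  · -- level t ≥ 4
    exact rung_of_levelBudgetAt (by omega) (hH hR hP hC t h4)

/-- **`PaleySosRung_closed`** — the same composition as a CLOSED term (the crux modulo the six
`stub_*` placeholders). When all six stubs land, this is the complete proof to propose with
`--workitem stmt-PneNP-9817`. -/
theorem PaleySosRung_closed : Summit.PneNP.PneNP.Theses.RamseyUncertifiable.PaleySosRung :=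
  PaleySosRung_of stub_filledReduction stub_twoPinLaw stub_coreKernels stub_levelTwo stub_levelThree
    stub_higherLevels

end

end Summit.PneNP.PneNP.Cruxes.PaleySosRung.TwoPinContractionFkmCores
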